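import Mathlib
import Summits.AtomisticToContinuum.Crystallization.Theorems.PricedLinkCensusSoftFourRingsLocalHelpers
import Summits.AtomisticToContinuum.Crystallization.Theorems.PricedLinkCensusSoftFourRingsTypeAPrep

/-!
# Crux `GappedShellCensus.FiveFoldRationingR` (stmt-AtomisticToContinuum-18071), line `Sketch` —
# stub `stub_ffrC5Core` (the finite core of the capped census),
# file 1/6: finset tools, handshake parity, and the link-pentagon bookkeeping (no chords)

Setting (abstract fan data on the twelve labels `Fin 12`): a family `tri` of `3`-element label sets,
two per side, and a symmetric irreflexive Boolean bond relation with degrees in `{4, 5}`; every bond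
is a side of exactly two members of `tri`, every bonded `3`-clique is in `tri`, every member of
`tri` has a vertex bonded to the other two, every `5`-valent label has only bonded fan triangles and
every `4`-valent label at most two.

This file: two-element finset tools (three-element ones are reused from the `PricedLinkCensus`
helpers `eq_three_of_mem_of_card`, `eq_three_of_two_mem`, `tri_swap23`, `tri_rotl`); the handshake
parity of a symmetric irreflexive Boolean relation (the swap is a fixed-point-free involution on
related ordered pairs); and, for a `5`-valent label `v` whose partners are enumerated `u : Fin 5 →
Fin 12` with fan triangles `{v, u i, u (i + 1)}`, the bookkeeping lemmas: consecutive partners are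
bonded, the five fan triangles are distinct, and (registered sub-goal `stub_ffrC5CoreChord`) two
bonded partners are consecutive — a chord `u i ~ u j` would make `{v, u i, u j}` a bonded
`3`-clique, hence a sixth fan triangle at `v`.
-/

noncomputable section

namespace Summit.AtomisticToContinuum.Crystallization.Theorems

open Finset

/-! ## Finset tools -/

/-- In a two-element finset, any member is one of two given distinct members. [folklore] -/
theorem ffrCC_of_card_two {α : Type*} [DecidableEq α] {F : Finset α} (h : F.card = 2) {a b : α}
    (ha : a ∈ F) (hb : b ∈ F) (hab : a ≠ b) {c : α} (hc : c ∈ F) : c = a ∨ c = b := by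
  have hsub : ({a, b} : Finset α) ⊆ F := by
    simp [Finset.insert_subset_iff, ha, hb]
  have heq : ({a, b} : Finset α) = F :=
    Finset.eq_of_subset_of_card_le hsub (by rw [h, Finset.card_pair hab])
  rw [← heq] at hc
  simpa using hc

/-- A two-element finset has a member other than any given member. [folklore] -/
theorem ffrCC_other_of_card_two {α : Type*} [DecidableEq α] {F : Finset α} (h : F.card = 2)
    {a : α} (ha : a ∈ F) : ∃ b ∈ F, b ≠ a := by
  obtain ⟨x, y, hxy, rfl⟩ := Finset.card_eq_two.1 h
  simp only [Finset.mem_insert, Finset.mem_singleton] at ha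
  rcases ha with rfl | rfl
  · exact ⟨y, by simp, hxy.symm⟩
  · exact ⟨x, by simp, hxy⟩

/-- Three distinct members do not fit into a finset with at most two elements. [folklore] -/
theorem ffrCC_absurd_of_card_le_two {α : Type*} [DecidableEq α] {F : Finset α} (h : F.card ≤ 2)
    {a b c : α} (ha : a ∈ F) (hb : b ∈ F) (hc : c ∈ F) (hab : a ≠ b) (hac : a ≠ c) (hbc : b ≠ c) :
    False := by
  have hsub : ({a, b, c} : Finset α) ⊆ F := by
    simp [Finset.insert_subset_iff, ha, hb, hc]
  have h3 : ({a, b, c} : Finset α).card = 3 := Finset.card_eq_three.2 ⟨a, b, c, hab, hac, hbc, rfl⟩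
  have := Finset.card_le_card hsub
  omega

/-- Handshake parity: for a symmetric irreflexive Boolean relation, the number of related ordered
pairs inside a finset is even (the swap is a fixed-point-free involution). [folklore] -/
theorem ffrCC_even_pairs {α : Type*} [DecidableEq α] (r : α → α → Bool)
    (hsymm : ∀ a b, r a b = r b a) (hirr : ∀ a, r a a = false) (D : Finset α) :
    Even (∑ a ∈ D, (D.filter fun b => r a b = true).card) := by
  have hsum : ∑ a ∈ D, (D.filter fun b => r a b = true).card =
      ((D ×ˢ D).filter fun p => r p.1 p.2 = true).card := by
    rw [Finset.card_filter, Finset.sum_product]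
    refine Finset.sum_congr rfl fun a _ => ?_
    rw [Finset.card_filter]
  rw [hsum, ← ZMod.natCast_eq_zero_iff_even, Finset.card_eq_sum_ones, Nat.cast_sum]
  refine Finset.sum_involution (fun p _ => p.swap) (fun p _ => by decide) ?_ ?_ (fun p _ => p.swap_swap)
  · intro p hp _ h
    simp only [Finset.mem_filter] at hp
    have h1 : p.1 = p.2 := congrArg Prod.snd h
    have := hp.2
    rw [h1, hirr] at this
    exact Bool.false_ne_true this
  · intro p hp
    simp only [Finset.mem_filter, Finset.mem_product] at hp ⊢
    exact ⟨⟨hp.1.2, hp.1.1⟩, by rw [Prod.fst_swap, Prod.snd_swap, hsymm]; exact hp.2⟩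

/-! ## Index arithmetic on `Fin 5` -/

/-- [folklore] -/
theorem ffrCC_fin5_cover (i j : Fin 5) : j = i ∨ j = i + 1 ∨ j = i + 2 ∨ j = i - 2 ∨ j = i - 1 := by
  revert i j; decide

/-! ## Bookkeeping in the link pentagon of a `5`-valent label -/

/-- Three pairwise bonded labels form a bonded triple. [folklore] -/
theorem ffrCC_bonded3 {bond : Fin 12 → Fin 12 → Bool} (bond_symm : ∀ v w, bond v w = bond w v)
    {a b c : Fin 12} (hab : bond a b = true) (hac : bond a c = true) (hbc : bond b c = true) :
    ∀ p ∈ ({a, b, c} : Finset (Fin 12)), ∀ q ∈ ({a, b, c} : Finset (Fin 12)), p ≠ q →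
      bond p q = true := by
  intro p hp q hq hpq
  simp only [Finset.mem_insert, Finset.mem_singleton] at hp hq
  rcases hp with rfl | rfl | rfl <;> rcases hq with rfl | rfl | rfl
  all_goals first | exact absurd rfl hpq | assumption | (rw [bond_symm]; assumption)

section Pentagon

variable {bond : Fin 12 → Fin 12 → Bool} {tri : Finset (Finset (Fin 12))}
  (bond_symm : ∀ v w, bond v w = bond w v) (bond_irrefl : ∀ v, bond v v = false)
  (bond_deg : ∀ v, 4 ≤ (Finset.univ.filter fun w => bond v w = true).card ∧
    (Finset.univ.filter fun w => bond v w = true).card ≤ 5)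
  (tri_card : ∀ S ∈ tri, S.card = 3)
  (bond_side : ∀ v w, bond v w = true →
    (tri.filter fun S' => ({v, w} : Finset (Fin 12)) ⊆ S').card = 2)
  (bond_tri : ∀ a b c, a ≠ b → b ≠ c → a ≠ c → bond a b = true → bond b c = true →
    bond a c = true → ({a, b, c} : Finset (Fin 12)) ∈ tri)
  (five_T : ∀ v, (Finset.univ.filter fun w => bond v w = true).card = 5 →
    ∀ S ∈ tri, v ∈ S → ∀ a ∈ S, ∀ b ∈ S, a ≠ b → bond a b = true)
  (four_T : ∀ v, (Finset.univ.filter fun w => bond v w = true).card = 4 →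
    ((tri.filter fun S => v ∈ S).filter
      fun S => ∀ a ∈ S, ∀ b ∈ S, a ≠ b → bond a b = true).card ≤ 2)

include bond_irrefl in
/-- A partner is never the label itself. [folklore] -/
theorem ffrCC_ne_of_bond {v a : Fin 12} (h : bond v a = true) : a ≠ v := by
  rintro rfl
  rw [bond_irrefl] at h
  exact Bool.false_ne_true h

include bond_irrefl in
/-- A partner `u j` of `v` lying in the fan triangle `{v, u i, u (i + 1)}` is `u i` or
`u (i + 1)`. [folklore] -/
theorem ffrCC_mem_T {v : Fin 12} {u : Fin 5 → Fin 12} (hu : Function.Injective u)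
    (hvu : ∀ i, bond v (u i) = true) {i j : Fin 5}
    (h : u j ∈ ({v, u i, u (i + 1)} : Finset (Fin 12))) : j = i ∨ j = i + 1 := by
  simp only [Finset.mem_insert, Finset.mem_singleton] at h
  rcases h with h | h | h
  · exact absurd h (ffrCC_ne_of_bond bond_irrefl (hvu j))
  · exact Or.inl (hu h)
  · exact Or.inr (hu h)

include bond_irrefl in
/-- The fan triangles `{v, u i, u (i + 1)}` are pairwise distinct. [folklore] -/
theorem ffrCC_T_inj {v : Fin 12} {u : Fin 5 → Fin 12} (hu : Function.Injective u)
    (hvu : ∀ i, bond v (u i) = true) {i j : Fin 5}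
    (h : ({v, u i, u (i + 1)} : Finset (Fin 12)) = {v, u j, u (j + 1)}) : i = j := by
  have h1 : u i ∈ ({v, u j, u (j + 1)} : Finset (Fin 12)) := by rw [← h]; simp
  have h2 : u (i + 1) ∈ ({v, u j, u (j + 1)} : Finset (Fin 12)) := by rw [← h]; simp
  have e1 := ffrCC_mem_T bond_irrefl hu hvu h1
  have e2 := ffrCC_mem_T bond_irrefl hu hvu h2
  omega

include five_T in
/-- Consecutive partners of a `5`-valent label are bonded. [folklore] -/
theorem ffrCC_uu {v : Fin 12} {u : Fin 5 → Fin 12}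
    (hv : (Finset.univ.filter fun w => bond v w = true).card = 5) (hu : Function.Injective u)
    (hT : ∀ i, ({v, u i, u (i + 1)} : Finset (Fin 12)) ∈ tri) (i : Fin 5) :
    bond (u i) (u (i + 1)) = true ∧ bond (u (i + 1)) (u i) = true := by
  have hne : u i ≠ u (i + 1) := fun h => by have := hu h; omega
  exact ⟨five_T v hv _ (hT i) (by simp) (u i) (by simp) (u (i + 1)) (by simp) hne,
    five_T v hv _ (hT i) (by simp) (u (i + 1)) (by simp) (u i) (by simp) hne.symm⟩

include bond_irrefl bond_tri in
/-- **No chords.** Two bonded partners of a `5`-valent label are consecutive in its link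
pentagon. [folklore] -/
theorem ffrCC_chord {v : Fin 12} {u : Fin 5 → Fin 12} (hu : Function.Injective u)
    (hvu : ∀ i, bond v (u i) = true)
    (hcl : ∀ S ∈ tri, v ∈ S → ∃ i, S = ({v, u i, u (i + 1)} : Finset (Fin 12)))
    {i j : Fin 5} (h : bond (u i) (u j) = true) : j = i + 1 ∨ j = i - 1 := by
  have hij : i ≠ j := by
    rintro rfl
    rw [bond_irrefl] at h
    exact Bool.false_ne_true h
  have hvi : v ≠ u i := (ffrCC_ne_of_bond bond_irrefl (hvu i)).symm
  have hvj : v ≠ u j := (ffrCC_ne_of_bond bond_irrefl (hvu j)).symm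
  have hmem := bond_tri v (u i) (u j) hvi (fun e => hij (hu e)) hvj (hvu i) h (hvu j)
  obtain ⟨k, hk⟩ := hcl _ hmem (by simp)
  have h1 : u i ∈ ({v, u k, u (k + 1)} : Finset (Fin 12)) := by rw [← hk]; simp
  have h2 : u j ∈ ({v, u k, u (k + 1)} : Finset (Fin 12)) := by rw [← hk]; simp
  have e1 := ffrCC_mem_T bond_irrefl hu hvu h1
  have e2 := ffrCC_mem_T bond_irrefl hu hvu h2
  omega

end Pentagon

/-- **Registered sub-goal `stub_ffrC5CoreChord` (no chords in a link pentagon).**  If the fan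
triangles at `v` are the five sets `{v, u i, u (i + 1)}` for an injective `u : Fin 5 → Fin 12` of
partners of `v`, and every bonded `3`-clique is a fan triangle, then two bonded partners `u i ~ u j`
are consecutive: `j = i ± 1`. [folklore] -/
theorem stub_ffrC5CoreChord (bond : Fin 12 → Fin 12 → Bool) (tri : Finset (Finset (Fin 12)))
    (bond_irrefl : ∀ v, bond v v = false)
    (bond_tri : ∀ a b c, a ≠ b → b ≠ c → a ≠ c → bond a b = true → bond b c = true →
      bond a c = true → ({a, b, c} : Finset (Fin 12)) ∈ tri)
    (v : Fin 12) (u : Fin 5 → Fin 12) (hu : Function.Injective u) (hvu : ∀ i, bond v (u i) = true)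
    (hcl : ∀ S ∈ tri, v ∈ S → ∃ i, S = ({v, u i, u (i + 1)} : Finset (Fin 12)))
    (i j : Fin 5) (h : bond (u i) (u j) = true) : j = i + 1 ∨ j = i - 1 :=
  ffrCC_chord bond_irrefl bond_tri hu hvu hcl h

end Summit.AtomisticToContinuum.Crystallization.Theorems

end
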